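import Summits.ResolutionOfSingularities.ResolutionOfSingularities.Theorems.FrobeniusClosingSteerThreadChain
import Summits.ResolutionOfSingularities.ResolutionOfSingularities.Theorems.FrobeniusClosingSteerThreadKoenig
import Mathlib.Data.Nat.Nth
import HarnessLib

/-!
# THREAD: an infinite thread of centres forces infinitely many births or infinite branching (modulo K(c))

W4.1, crux `Steer` (stmt-ResolutionOfSingularities-16345), σ-residual HIGH half, §σ2.21 HIGH-WANDER FOREST (res-L0-w41-strat-2 delta
rev 13 c7828a1d38db410e; res-L0-w41-plan-1 RULINGS 14d/15a: `ThreadWanderTwoN` → res-D-pv-011 AS res-L0-w41-stub-7). Theses-free,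
def-free core of `ThreadWanderTwoN` (stub-7's Θ3, SCOPING 2026-08-27T08:24Z): `ThreadChain.births_or_branching_of_thread`.

Hypotheses (all in-skeleton): the W4.1 tower (`hR0`, `hbl`, strict steps, `hsp`, regular members of dimension `n`), σ-data at the
positive-dimensional centres (`hvis`: prime, multiplicity clause, minimality among singular primes — from `IsSigmaTopCentre`),
«heights do not grow up the tower» (`hheight`, the dimension inequality; stub-7's BRICK Θ2), the K-debts `K(c)` for `c < n`
(`hK`: bodies of `NoEternalIsolatedRadicandChain p c`; at `n = 4`: K(1) p500126, K(2) modulo Lipman p505893, K(3) modulo CP2019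
p509311, K(0) vacuous), and the forest words as parametric predicates (`Pos`, `Anc` = bodies of strat-2's `IsPosStep`,
`IsAncestorStep`). Conclusion: an infinite pairwise-ancestral set of stages forces `{roots}.Infinite ∨ ∃ i, {children of i}.Infinite`
(bodies of `HasInfiniteBirths` / `HasInfiniteBranching`).

Proof: strong induction on the common height `c` of the thread. The thread primes `W m := P (next visit) ∩ R m` all have height `c`
(`hheight` twice); SATURATE the thread by every stage whose centre is `W m`; a stage in between whose centre lies strictly below `W m`
is a HIT, of height `< c`. Finitely many hits ⇒ beyond them Ĝ (`ThreadChain.not_noEternalChain_of_thread`) builds the eternal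
isolated radicand chain of dimension `c`, contradicting `K(c)`; infinitely many hits ⇒ infinitely many positive steps of one height
`h < c` ⇒ GRADED KÖNIG (`koenig_nat` on the height-`h` nodes; ancestry preserves height) ⇒ an infinite thread of height `h` ⇒ induction.
OURS (the W4.1 engine; corrects strat-2 memo §6″ (F-b)(ii)/(iii): no divisor-resolution lemma is needed).
[cite: Cutkosky2014, §2.1] [cite: Matsumura1987, Thm. 15.5, Thm. 19.3]
-/

noncomputable section

-- `Summit.<S>.<S>.…` duplicates the summit name by design (single-problem summit).
set_option linter.dupNamespace false

open Polynomial IsLocalRing Literature.AlgebraicGeometry.Resolution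

namespace Summit.ResolutionOfSingularities.ResolutionOfSingularities.Theorems.SwitchingDichotomy.ThreadChain

/-! ## §5 THREAD: an infinite thread forces infinitely many births or infinite branching (modulo K(c), c < n) -/

section Thread

variable {k : Type} {K : Type} [Field k] [Field K] [Algebra k K]

/-- **K(0) is vacuous**: the body of `NoEternalIsolatedRadicandChain p 0` holds — a regular local ring of dimension `0` is a field
and has no quadratic transform. OURS bookkeeping. [folklore] -/
theorem noEternalChain_zero (p : ℕ) :
    ∀ (L : Type) [Field L] [CharP L p] (S : ℕ → Subring L) [∀ m, IsLocalRing (S m)]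
        (hle : ∀ m, S m ≤ S (m + 1)) (f g : ∀ m, S m) (x : ∀ m, S (m + 1)),
        (∀ m, IsRegularLocalRing (S m)) → (∀ m, IsExcellentRing (S m)) → (∀ m, ringKrullDim (S m) = (0 : ℕ)) →
        (∀ m, IsQuadraticTransform (S m) (S (m + 1))) →
        (∀ m, Ideal.span ((fun y : S m => (⟨(y : L), hle m y.2⟩ : S (m + 1))) ''
            (maximalIdeal (S m) : Set (S m))) = Ideal.span {x m}) →
        (∀ m, ((f (m + 1) : S (m + 1)) : L) * ((x m : S (m + 1)) : L) ^ p =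
            ((f m : S m) : L) - ((g m : S m) : L) ^ p) →
        (∀ m, ∃ h : S m, f m - h ^ p ∈ maximalIdeal (S m) ^ p) →
        (∀ m, ∀ (Q : Ideal (AdjoinRoot ((X : (S m)[X]) ^ p - C (f m)))) [Q.IsPrime],
            (∃ Q' : Ideal (AdjoinRoot ((X : (S m)[X]) ^ p - C (f m))), Q'.IsPrime ∧ Q < Q') →
            IsRegularLocalRing (Localization.AtPrime Q)) →
        False := by
  intro L _ _ S _ hle f g x hreg _ hdim hqt _ _ _ _
  obtain ⟨_, y, hy, hy0, -⟩ := hqt 0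
  haveI := hreg 0
  have hbot : maximalIdeal (S 0) = ⊥ := by
    rw [← Ideal.height_eq_zero_iff_eq_bot]
    have h := IsLocalRing.maximalIdeal_height_eq_ringKrullDim (R := S 0)
    rw [hdim 0] at h
    exact_mod_cast h
  have hy' : y ∈ (⊥ : Ideal (S 0)) := hbot ▸ hy
  exact hy0 ((Submodule.mem_bot _).mp hy')

/-- **THREAD (`ThreadWanderTwoN` of §σ2.21, Theses-free core; stub-7's Θ3).** For the W4.1 tower (as in
`not_noEternalChain_of_thread`) with members of dimension `n`, σ-data at the positive-dimensional centres (`hvis`: prime, the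
multiplicity clause, minimality among singular primes), heights not growing up the tower (`hheight`, the dimension inequality),
and the K-debts `K(c)` for `c < n` (`hK`, bodies of `NoEternalIsolatedRadicandChain p c`): an infinite THREAD (pairwise-ancestral
infinite set of stages, `Anc` = the body of strat-2's `IsAncestorStep`) forces infinitely many BIRTHS (roots) or INFINITE BRANCHING.
Proof: strong induction on the height `c` of the thread. Saturate the thread by all stages whose centre IS the thread prime; a
stage strictly between whose centre lies BELOW the thread prime is a HIT and has height `< c` (`hheight`); finitely many hits ⇒
Ĝ (`not_noEternalChain_of_thread`) contradicts `K(c)`; infinitely many hits ⇒ infinitely many positive steps of one height `h < c` ⇒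
graded König (`koenig_nat` on the height-`h` nodes) ⇒ a thread of height `h` ⇒ induction. OURS (W4.1 engine; strat-2 §6″ corrected
per stub-7's SCOPING 2026-08-27T08:24Z). [cite: Cutkosky2014, §2.1] [cite: Matsumura1987, Thm. 15.5] -/
theorem births_or_branching_of_thread (p : ℕ) [hp : Fact p.Prime] [CharP K p]
    (O : ValuationSubring K) (A₀ : Subalgebra k K) (h₀ : A₀.toSubring ≤ O.toSubring) (hfg : A₀.FG)
    (R : ℕ → Subring K) (P : (i : ℕ) → Ideal (R i)) (s : ℕ → K) (n : ℕ)
    (hR0 : R 0 = locAtCentre A₀.toSubring O)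
    (hbl : ∀ i, IsLocalBlowupAlong O (R i) (P i) (R (i + 1)))
    (hst : ∀ i, ∃ x g : K, ((∃ hx : x ∈ R i, (⟨x, hx⟩ : R i) ∈ P i) ∧ x ≠ 0 ∧
      ∀ y : R i, y ∈ P i → O.valuation (y : K) ≤ O.valuation x) ∧ g ∈ R i ∧ s i = x * s (i + 1) + g)
    (hsp : ∀ i, s i ^ p ∈ R i)
    (hregR : ∀ i, IsRegularLocalRing (R i))
    (hdim : ∀ i, ringKrullDim (R i) = n)
    (hheight : ∀ i m (hle : R i ≤ R m) (Q : Ideal (R m)) [Q.IsPrime],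
      Q.height ≤ (Q.comap (Subring.inclusion hle)).height)
    (hvis : ∀ i, (∃ _ : IsLocalRing (R i), P i ≠ maximalIdeal (R i)) →
      (P i).IsPrime ∧ (∃ g : R i, (⟨s i ^ p, hsp i⟩ : R i) - g ^ p ∈ P i ^ p) ∧
      (∀ (Q : Ideal (R i)) [Q.IsPrime], Q < P i →
        IsRegularLocalRing (AdjoinRoot ((X : (Localization.AtPrime Q)[X]) ^ p -
          C (algebraMap (R i) (Localization.AtPrime Q) ⟨s i ^ p, hsp i⟩)))))
    (hK : ∀ c, c < n → ∀ (L : Type) [Field L] [CharP L p] (S : ℕ → Subring L) [∀ m, IsLocalRing (S m)]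
        (hle : ∀ m, S m ≤ S (m + 1)) (f g : ∀ m, S m) (x : ∀ m, S (m + 1)),
        (∀ m, IsRegularLocalRing (S m)) → (∀ m, IsExcellentRing (S m)) → (∀ m, ringKrullDim (S m) = c) →
        (∀ m, IsQuadraticTransform (S m) (S (m + 1))) →
        (∀ m, Ideal.span ((fun y : S m => (⟨(y : L), hle m y.2⟩ : S (m + 1))) ''
            (maximalIdeal (S m) : Set (S m))) = Ideal.span {x m}) →
        (∀ m, ((f (m + 1) : S (m + 1)) : L) * ((x m : S (m + 1)) : L) ^ p =
            ((f m : S m) : L) - ((g m : S m) : L) ^ p) →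
        (∀ m, ∃ h : S m, f m - h ^ p ∈ maximalIdeal (S m) ^ p) →
        (∀ m, ∀ (Q : Ideal (AdjoinRoot ((X : (S m)[X]) ^ p - C (f m)))) [Q.IsPrime],
            (∃ Q' : Ideal (AdjoinRoot ((X : (S m)[X]) ^ p - C (f m))), Q'.IsPrime ∧ Q < Q') →
            IsRegularLocalRing (Localization.AtPrime Q)) →
        False)
    (Pos : ℕ → Prop) (hPos : ∀ i, Pos i ↔ ∃ _ : IsLocalRing (R i), P i ≠ maximalIdeal (R i))
    (Anc : ℕ → ℕ → Prop) (hAnc : ∀ i j, Anc i j ↔ i < j ∧ Pos i ∧ Pos j ∧ (P j).height = (P i).height ∧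
      ∃ h : R i ≤ R j, (P j).comap (Subring.inclusion h) = P i)
    (J : Set ℕ) (hJ : J.Infinite) (hJA : ∀ i ∈ J, ∀ j ∈ J, i < j → Anc i j) :
    {j | Pos j ∧ ∀ i, ¬ Anc i j}.Infinite ∨ ∃ i, {j | Anc i j ∧ ∀ k, Anc k j → k ≤ i}.Infinite := by
  classical
  by_contra hcon
  have hroots : {j | Pos j ∧ ∀ i, ¬ Anc i j}.Finite := Set.not_infinite.mp fun h => hcon (Or.inl h)
  have hbr : ∀ i, {j | Anc i j ∧ ∀ k, Anc k j → k ≤ i}.Finite := fun i =>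
    Set.not_infinite.mp fun h => hcon (Or.inr ⟨i, h⟩)
  -- ### generalities on the tower
  have hmono : Monotone R := monotone_nat_of_le_succ fun i => (hbl i).isLocalBlowup.le
  haveI hloc : ∀ i, IsLocalRing (R i) := fun i => by haveI := hregR i; infer_instance
  -- transitivity of `Anc` and the chain property (strat-2's `isAncestorStep_trans` / `_of_common_descendant`, bodies)
  have hAtrans : ∀ {i j l}, Anc i j → Anc j l → Anc i l := by
    intro i j l h₁ h₂
    obtain ⟨hij, hpi, -, hh₁, e₁, hc₁⟩ := (hAnc i j).mp h₁
    obtain ⟨hjl, -, hpl, hh₂, e₂, hc₂⟩ := (hAnc j l).mp h₂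
    refine (hAnc i l).mpr ⟨hij.trans hjl, hpi, hpl, hh₂.trans hh₁, e₁.trans e₂, ?_⟩
    have hcomp : Subring.inclusion (e₁.trans e₂) = (Subring.inclusion e₂).comp (Subring.inclusion e₁) :=
      RingHom.ext fun _ => rfl
    rw [hcomp, ← Ideal.comap_comap, hc₂, hc₁]
  have hAchain : ∀ {i j l}, i < j → Anc i l → Anc j l → Anc i j := by
    intro i j l hij h₁ h₂
    obtain ⟨-, hpi, -, hh₁, e₁, hc₁⟩ := (hAnc i l).mp h₁
    obtain ⟨-, hpj, -, hh₂, e₂, hc₂⟩ := (hAnc j l).mp h₂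
    refine (hAnc i j).mpr ⟨hij, hpi, hpj, hh₂.symm.trans hh₁, hmono hij.le, ?_⟩
    have hcomp : Subring.inclusion e₁ = (Subring.inclusion e₂).comp (Subring.inclusion (hmono hij.le)) :=
      RingHom.ext fun _ => rfl
    rw [← hc₁, hcomp, ← Ideal.comap_comap, hc₂]
  -- comaps along the tower compose, and do not depend on the inclusion proof
  have hcomap_tr : ∀ {a b d : ℕ} (hab : a ≤ b) (hbd : b ≤ d) (Q : Ideal (R d)),
      (Q.comap (Subring.inclusion (hmono (hab.trans hbd)))) =
        (Q.comap (Subring.inclusion (hmono hbd))).comap (Subring.inclusion (hmono hab)) := by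
    intro a b d hab hbd Q
    rw [Ideal.comap_comap]
    rfl
  have hcomap_irrel : ∀ {a b : ℕ} (h h' : R a ≤ R b) (Q : Ideal (R b)),
      Q.comap (Subring.inclusion h) = Q.comap (Subring.inclusion h') := fun _ _ _ => rfl
  have hcomap_self : ∀ {a : ℕ} (h : R a ≤ R a) (Q : Ideal (R a)), Q.comap (Subring.inclusion h) = Q := by
    intro a h Q
    ext y
    rw [Ideal.mem_comap]
    rfl
  -- the maximal ideal has height `n`; positive-dimensional centres have height `< n`
  have hhtmax : ∀ i, (maximalIdeal (R i)).height = n := by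
    intro i
    haveI := hregR i
    have h := IsLocalRing.maximalIdeal_height_eq_ringKrullDim (R := R i)
    rw [hdim i] at h
    exact_mod_cast h
  -- ### the statement proved by strong induction on the height `c` of the thread
  suffices main : ∀ c : ℕ, ¬ ∃ J : Set ℕ, J.Infinite ∧ (∀ i ∈ J, ∀ j ∈ J, i < j → Anc i j) ∧
      ∀ i ∈ J, (P i).height = c by
    obtain ⟨i₀, hi₀⟩ := hJ.nonempty
    have hpos₀ : ∃ _ : IsLocalRing (R i₀), P i₀ ≠ maximalIdeal (R i₀) := by
      obtain ⟨i₁, hi₁, hlt⟩ := hJ.exists_gt i₀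
      exact (hPos i₀).mp ((hAnc i₀ i₁).mp (hJA i₀ hi₀ i₁ hi₁ hlt)).2.1
    haveI : (P i₀).IsPrime := (hvis i₀ hpos₀).1
    obtain ⟨c, hc'⟩ := ENat.ne_top_iff_exists.mp ((P i₀).height_ne_top Ideal.IsPrime.ne_top')
    have hc : (P i₀).height = c := hc'.symm
    refine main c ⟨J, hJ, hJA, fun i hi => ?_⟩
    rcases lt_trichotomy i i₀ with h | rfl | h
    · rw [← ((hAnc i i₀).mp (hJA i hi i₀ hi₀ h)).2.2.2.1]; exact hc
    · exact hc
    · rw [((hAnc i₀ i).mp (hJA i₀ hi₀ i hi h)).2.2.2.1]; exact hc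
  intro c
  induction c using Nat.strong_induction_on with
  | _ c ih =>
  rintro ⟨J, hJ, hJA, hJc⟩
  -- ### A. enumerate the thread
  have hjmono : StrictMono (Nat.nth (· ∈ J)) := Nat.nth_strictMono hJ
  set j : ℕ → ℕ := Nat.nth (· ∈ J) with hjdef
  have hjmem : ∀ k, j k ∈ J := fun k => Nat.nth_mem_of_infinite hJ k
  have hjle : ∀ k, k ≤ j k := fun k => hjmono.id_le k
  have hjA : ∀ {k l}, k < l → Anc (j k) (j l) := fun {k l} h => hJA _ (hjmem k) _ (hjmem l) (hjmono h)
  have hjpos : ∀ k, ∃ _ : IsLocalRing (R (j k)), P (j k) ≠ maximalIdeal (R (j k)) := fun k =>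
    (hPos _).mp ((hAnc _ _).mp (hjA (Nat.lt_succ_self k))).2.1
  haveI hjprime : ∀ k, (P (j k)).IsPrime := fun k => (hvis _ (hjpos k)).1
  have hjht : ∀ k, (P (j k)).height = c := fun k => hJc _ (hjmem k)
  have hjP : ∀ {k l} (h : k ≤ l), (P (j l)).comap (Subring.inclusion (hmono (hjmono.monotone h))) = P (j k) := by
    intro k l h
    rcases h.eq_or_lt with rfl | h
    · exact hcomap_self _ _
    · obtain ⟨-, -, -, -, e, hc⟩ := (hAnc _ _).mp (hjA h)
      rw [hcomap_irrel _ e]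
      exact hc
  -- `c < n`
  have hcn : c < n := by
    obtain ⟨_, hne⟩ := hjpos 0
    have h1 := Ideal.height_add_one_le_of_lt_of_isPrime
      (lt_of_le_of_ne (IsLocalRing.le_maximalIdeal (hjprime 0).ne_top) hne)
    rw [hjht 0, hhtmax] at h1
    have : (c : ℕ∞) + 1 ≤ n := h1
    exact_mod_cast (ENat.add_one_le_iff (ENat.coe_ne_top c)).mp this
  -- ### B. the next visit `ν m` and the thread primes `W m`
  have hνex : ∀ m, ∃ k, m ≤ j k := fun m => ⟨m, hjle m⟩
  let ν : ℕ → ℕ := fun m => Nat.find (hνex m)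
  have hνspec : ∀ m, m ≤ j (ν m) := fun m => Nat.find_spec (hνex m)
  have hνmin : ∀ m k, m ≤ j k → ν m ≤ k := fun m k h => Nat.find_min' (hνex m) h
  have hνvisit : ∀ k, ν (j k) = k := by
    intro k
    refine le_antisymm (hνmin _ _ le_rfl) ?_
    by_contra h
    push Not at h
    exact absurd (hνspec (j k)) (not_le.mpr (hjmono h))
  have hνmono : ∀ m, ν m ≤ ν (m + 1) := fun m => hνmin _ _ ((Nat.le_succ m).trans (hνspec (m + 1)))
  let W : (m : ℕ) → Ideal (R m) := fun m => (P (j (ν m))).comap (Subring.inclusion (hmono (hνspec m)))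
  haveI hWprime : ∀ m, (W m).IsPrime := fun m => Ideal.comap_isPrime _ _
  -- `W m = P (j l) ∩ R m` for EVERY later visit `l`
  have hWany : ∀ m l (h : m ≤ j l), W m = (P (j l)).comap (Subring.inclusion (hmono h)) := by
    intro m l h
    have hνl : ν m ≤ l := hνmin _ _ h
    change (P (j (ν m))).comap (Subring.inclusion (hmono (hνspec m))) = _
    rw [← hjP hνl, Ideal.comap_comap]
    rfl
  have hWP : ∀ k, W (j k) = P (j k) := by
    intro k
    rw [hWany (j k) k le_rfl]
    exact hcomap_self _ _
  have hWcomap : ∀ m, ∃ h : R m ≤ R (m + 1), (W (m + 1)).comap (Subring.inclusion h) = W m := by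
    intro m
    refine ⟨hmono (Nat.le_succ m), ?_⟩
    rw [hWany (m + 1) (ν (m + 1)) (hνspec _), hWany m (ν (m + 1)) ((Nat.le_succ m).trans (hνspec _)),
      Ideal.comap_comap]
    rfl
  have hWcomap' : ∀ m d, (W (m + d)).comap (Subring.inclusion (hmono (Nat.le_add_right m d))) = W m := by
    intro m d
    rw [hWany (m + d) (ν (m + d)) (hνspec _), hWany m (ν (m + d)) ((Nat.le_add_right m d).trans (hνspec _)),
      Ideal.comap_comap]
    rfl
  -- ### E. every thread prime has height `c`
  have hWht : ∀ m, j 0 ≤ m → (W m).height = c := by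
    intro m hm
    apply le_antisymm
    · have h1 := hheight (j 0) m (hmono hm) (W m)
      obtain ⟨d, rfl⟩ := Nat.exists_eq_add_of_le hm
      rw [hWcomap' (j 0) d, hWP 0, hjht 0] at h1
      exact h1
    · have h1 := hheight m (j (ν m)) (hmono (hνspec m)) (P (j (ν m)))
      rw [hjht] at h1
      exact h1
  have hWne : ∀ m, j 0 ≤ m → W m ≠ maximalIdeal (R m) := by
    intro m hm h
    have h1 := hWht m hm
    rw [h, hhtmax] at h1
    have : n = c := by exact_mod_cast h1
    omega
  have hWpos : ∀ m, j 0 ≤ m → ∀ Q : Ideal (R m), Q ≤ W m → ∃ _ : IsLocalRing (R m), Q ≠ maximalIdeal (R m) :=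
    fun m hm Q hQ => ⟨inferInstance, fun h =>
      hWne m hm (le_antisymm (IsLocalRing.le_maximalIdeal (hWprime m).ne_top) (h ▸ hQ))⟩
  -- ### D. saturate: all stages whose centre IS the thread prime
  set V : Set ℕ := {m | j 0 ≤ m ∧ P m = W m} with hVdef
  have hjV : ∀ k, j k ∈ V := fun k => ⟨hjmono.monotone (Nat.zero_le k), (hWP k).symm⟩
  have hVinf : V.Infinite :=
    (Set.infinite_range_of_injective hjmono.injective).mono (by rintro _ ⟨k, rfl⟩; exact hjV k)
  have hvmono : StrictMono (Nat.nth (· ∈ V)) := Nat.nth_strictMono hVinf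
  set v : ℕ → ℕ := Nat.nth (· ∈ V) with hvdef
  have hvmem : ∀ k, v k ∈ V := fun k => Nat.nth_mem_of_infinite hVinf k
  have hvle : ∀ k, k ≤ v k := fun k => hvmono.id_le k
  have hvsurj : ∀ m ∈ V, ∃ k, v k = m := fun m hm => ⟨Nat.count (· ∈ V) m, Nat.nth_count hm⟩
  have hv0 : ∀ k, j 0 ≤ v k := fun k => (hvmem k).1
  -- ### F. the hits
  set H : Set ℕ := {m | j 0 ≤ m ∧ m ∉ V ∧ P m ≤ W m} with hHdef
  by_cases hH : H.Finite
  · -- finitely many hits: beyond them the thread is an eternal isolated radicand chain (Ĝ), contradicting K(c)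
    obtain ⟨N, hN⟩ : ∃ N, ∀ m ∈ H, m < N := by
      obtain ⟨N, hN⟩ := hH.bddAbove
      exact ⟨N + 1, fun m hm => Nat.lt_succ_of_le (hN hm)⟩
    let j' : ℕ → ℕ := fun k => v (N + k)
    have hj'mono : StrictMono j' := fun a b h => hvmono (by omega)
    have hj'0 : ∀ k, j 0 ≤ j' k := fun k => hv0 _
    have hNj' : ∀ k, N ≤ j' k := fun k => (Nat.le_add_right N k).trans (hvle _)
    have hj'P : ∀ k, W (j' k) = P (j' k) := fun k => (hvmem (N + k)).2.symm
    have hj'pos : ∀ k, ∃ _ : IsLocalRing (R (j' k)), P (j' k) ≠ maximalIdeal (R (j' k)) :=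
      fun k => hWpos _ (hj'0 k) _ (hj'P k ▸ le_rfl)
    have hnohit : ∀ m, j' 0 ≤ m → (∀ k, m ≠ j' k) → ¬ P m ≤ W m := by
      intro m hm hne hPW
      have hmV : m ∉ V := by
        intro hmV
        obtain ⟨k, hk⟩ := hvsurj m hmV
        have hNk : N ≤ k := by
          by_contra hlt
          push Not at hlt
          have : v k < v N := hvmono hlt
          have h2 : v N ≤ m := by simpa [j'] using hm
          omega
        obtain ⟨d, rfl⟩ := Nat.exists_eq_add_of_le hNk
        exact hne d hk.symm
      have hmH : m ∈ H := ⟨(hj'0 0).trans hm, hmV, hPW⟩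
      have := hN m hmH
      have := hNj' 0
      omega
    refine not_noEternalChain_of_thread p O A₀ h₀ hfg R P s c hR0 hbl hst hsp hregR j' hj'mono W
      (fun m _ => hWprime m) hj'P (fun m _ => hWcomap m) hnohit
      (fun k => by rw [← hj'P k]; exact hWht _ (hj'0 k))
      (fun k => (hvis _ (hj'pos k)).2.1)
      (fun k Q _ hQ => (hvis _ (hj'pos k)).2.2 Q hQ) (hK c hcn)
  · -- infinitely many hits: they are positive steps of height `< c`; graded König gives a thread of smaller height
    have hHinf : H.Infinite := hH
    have hHpos : ∀ m ∈ H, Pos m := fun m hm => (hPos m).mpr (hWpos m hm.1 _ hm.2.2)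
    have hHlt : ∀ m ∈ H, ∃ h, h < c ∧ (P m).height = h := by
      intro m hm
      haveI : (P m).IsPrime := (hvis m (hWpos m hm.1 _ hm.2.2)).1
      have hne : P m ≠ W m := fun h => hm.2.1 ⟨hm.1, h⟩
      have h1 := Ideal.height_add_one_le_of_lt_of_isPrime (lt_of_le_of_ne hm.2.2 hne)
      rw [hWht m hm.1] at h1
      obtain ⟨h, hh⟩ := ENat.ne_top_iff_exists.mp ((P m).height_ne_top Ideal.IsPrime.ne_top')
      refine ⟨h, ?_, hh.symm⟩
      rw [← hh] at h1
      have : (h : ℕ∞) + 1 ≤ c := h1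
      exact_mod_cast (ENat.add_one_le_iff (ENat.coe_ne_top h)).mp this
    -- pigeonhole on the height
    obtain ⟨h, hhc, hSinf⟩ : ∃ h, h < c ∧ {m | Pos m ∧ (P m).height = h}.Infinite := by
      by_contra hall
      push Not at hall
      apply hHinf
      refine ((Finset.range c).finite_toSet.biUnion fun h hh =>
        hall h (Finset.mem_range.mp hh)).subset ?_
      intro m hm
      obtain ⟨h, hhc, hh⟩ := hHlt m hm
      exact Set.mem_biUnion (Finset.mem_range.mpr hhc) ⟨hHpos m hm, hh⟩
    -- graded König
    obtain ⟨J₂, hJ₂, hJ₂A⟩ := koenig_nat (A := fun i l => Anc i l ∧ (P l).height = h)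
      (S := {m | Pos m ∧ (P m).height = h})
      (fun hil => ((hAnc _ _).mp hil.1).1)
      (fun hil => ⟨((hAnc _ _).mp hil.1).2.1, by rw [← ((hAnc _ _).mp hil.1).2.2.2.1]; exact hil.2⟩)
      (fun h₁ h₂ => ⟨hAtrans h₁.1 h₂.1, h₂.2⟩)
      (fun hil h₁ h₂ => ⟨hAchain hil h₁.1 h₂.1, by rw [← ((hAnc _ _).mp h₂.1).2.2.2.1]; exact h₂.2⟩)
      hSinf
      (hroots.subset fun l hl => ⟨hl.1.1, fun i hi => hl.2 i ⟨hi, hl.1.2⟩⟩)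
      (fun i => (hbr i).subset fun l hl => ⟨hl.1.1, fun k' hk' => hl.2 k' ⟨hk', hl.1.2⟩⟩)
    refine ih h hhc ⟨J₂, hJ₂, fun i hi l hl hil => (hJ₂A i hi l hl hil).1, fun i hi => ?_⟩
    obtain ⟨l, hl, hil⟩ := hJ₂.exists_gt i
    have hA := hJ₂A i hi l hl hil
    rw [← ((hAnc _ _).mp hA.1).2.2.2.1]
    exact hA.2

end Thread

end Summit.ResolutionOfSingularities.ResolutionOfSingularities.Theorems.SwitchingDichotomy.ThreadChain

end
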